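import Summits.Ventures.PercRepro.SquarePos0Part13
import Summits.Ventures.PercRepro.SquarePos4Part9
import Summits.Ventures.PercRepro.SquarePos5Part11
import Summits.Ventures.PercRepro.SquarePos12Part6
import Summits.Ventures.PercRepro.SquarePos13Part5
import Summits.Ventures.PercRepro.SquarePos15Part4

/-!
# The square lemma, III: assembly — `square_of_badTwo`, `noThreeTwo`, and (Σ)

Dossier proofs/MINE1-theoremS.md, Addendum 82 (mine-1, gen 43). The six generated case analyses
`sq_core_pos0`, `sq_core_pos4`, `sq_core_pos5`, `sq_core_pos12`, `sq_core_pos13`, `sq_core_pos15`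
cover the orbits of the sixteen positions `(r ∈ b, r ∈ a, q ∈ b', q ∈ a')` under the symmetries
of `SqCtx`, each with the colours of the K-mono edges normalised (`c1 b = false`, and
`c1 b' = false` where the swap `a' ↔ b'` or `a ↔ b` stabilises the position). This file
normalises the colours (`sq_pos*_any`), dispatches the positions (`square_core`) and proves

* **`square_of_badTwo`** — the square lemma: two bad two-edge points `q ≠ r` have
  `K_q = {x, x + r}` and `K_r = {x, x + q}`;
* **`noThreeTwo : NoThreeTwo α`** — three bad two-edge points are impossible (the squares of
  `q` with `r` and with `p` give `{x, x + r} = {y, y + p}`, forcing `r = p`);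
* **`conjSigma_holds : ConjSigma α`** (and `conjOmega_holds`, `omegaCore_holds`) — the
  kernel chain `ConjSigma ⟸ ConjOmega ⟸ OmegaCore ⟸ NoThreeTwo` closes.
-/

namespace PercRepro.MSTight

open Finset

variable {α : Type*} [DecidableEq α] {U : Finset α} {F : Finset (Finset α)}
  {c0 c1 : Finset α → Bool} {q r : α} {b a b' a' : Finset α}

section Normalisers

omit [DecidableEq α] in
/-- The other `c1`-colour of a pair with different `c1`-colours. -/
theorem c1_other_eq_true (hopp : c1 a ≠ c1 b) (hδ : c1 b = false) : c1 a = true := by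
  cases h : c1 a
  · exact absurd (h.trans hδ.symm) hopp
  · rfl

omit [DecidableEq α] in
/-- The other `c1`-colour of a pair with different `c1`-colours. -/
theorem c1_other_eq_false (hopp : c1 a ≠ c1 b) (hδ : c1 b = true) : c1 a = false := by
  cases h : c1 a
  · rfl
  · exact absurd (h.trans hδ.symm) hopp

/-- A Boolean that is not `false` is `true`. -/
theorem bool_true_of_not_false {x : Bool} (h : ¬ x = false) : x = true := by
  cases x
  · exact absurd rfl h
  · rfl

/-- Position `0` for every colouring: `a' ↔ b'` and the colour swap fix both colours. -/
theorem sq_pos0_any (H : SqCtx U F c0 c1 q r b a b' a') (hrb : r ∉ b) (hra : r ∉ a)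
    (hqb' : q ∉ b') (hqa' : q ∉ a') : False := by
  by_cases hδ : c1 b = false
  · by_cases hε : c1 b' = false
    · exact sq_core_pos0 H hrb hra hqb' hqa' hδ hε
    · exact sq_core_pos0 H.swap_ab' hrb hra hqa' hqb' hδ
        (c1_other_eq_false H.hopp' (bool_true_of_not_false hε))
  · have hδ' := bool_true_of_not_false hδ
    by_cases hε : c1 b' = false
    · exact sq_core_pos0 H.compl.swap_ab' hrb hra hqa' hqb' (by simp [hδ'])
        (by simp [c1_other_eq_true H.hopp' hε])
    · exact sq_core_pos0 H.compl hrb hra hqb' hqa' (by simp [hδ'])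
        (by simp [bool_true_of_not_false hε])

/-- Position `4` for every colouring: `a ↔ b` and the colour swap fix both colours. -/
theorem sq_pos4_any (H : SqCtx U F c0 c1 q r b a b' a') (hrb : r ∉ b) (hra : r ∉ a)
    (hqb' : q ∈ b') (hqa' : q ∉ a') : False := by
  by_cases hδ : c1 b = false
  · by_cases hε : c1 b' = false
    · exact sq_core_pos4 H hrb hra hqb' hqa' hδ hε
    · exact sq_core_pos4 H.swap_ab.compl hra hrb hqb' hqa'
        (by simp [c1_other_eq_true H.hopp hδ]) (by simp [bool_true_of_not_false hε])
  · have hδ' := bool_true_of_not_false hδ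
    by_cases hε : c1 b' = false
    · exact sq_core_pos4 H.swap_ab hra hrb hqb' hqa' (c1_other_eq_false H.hopp hδ') hε
    · exact sq_core_pos4 H.compl hrb hra hqb' hqa' (by simp [hδ'])
        (by simp [bool_true_of_not_false hε])

/-- Position `12` for every colouring. -/
theorem sq_pos12_any (H : SqCtx U F c0 c1 q r b a b' a') (hrb : r ∉ b) (hra : r ∉ a)
    (hqb' : q ∈ b') (hqa' : q ∈ a') : False := by
  by_cases hδ : c1 b = false
  · by_cases hε : c1 b' = false
    · exact sq_core_pos12 H hrb hra hqb' hqa' hδ hε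
    · exact sq_core_pos12 H.swap_ab' hrb hra hqa' hqb' hδ
        (c1_other_eq_false H.hopp' (bool_true_of_not_false hε))
  · have hδ' := bool_true_of_not_false hδ
    by_cases hε : c1 b' = false
    · exact sq_core_pos12 H.compl.swap_ab' hrb hra hqa' hqb' (by simp [hδ'])
        (by simp [c1_other_eq_true H.hopp' hε])
    · exact sq_core_pos12 H.compl hrb hra hqb' hqa' (by simp [hδ'])
        (by simp [bool_true_of_not_false hε])

/-- Position `13` for every colouring. -/
theorem sq_pos13_any (H : SqCtx U F c0 c1 q r b a b' a') (hrb : r ∈ b) (hra : r ∉ a)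
    (hqb' : q ∈ b') (hqa' : q ∈ a') : False := by
  by_cases hδ : c1 b = false
  · by_cases hε : c1 b' = false
    · exact sq_core_pos13 H hrb hra hqb' hqa' hδ hε
    · exact sq_core_pos13 H.swap_ab' hrb hra hqa' hqb' hδ
        (c1_other_eq_false H.hopp' (bool_true_of_not_false hε))
  · have hδ' := bool_true_of_not_false hδ
    by_cases hε : c1 b' = false
    · exact sq_core_pos13 H.compl.swap_ab' hrb hra hqa' hqb' (by simp [hδ'])
        (by simp [c1_other_eq_true H.hopp' hε])
    · exact sq_core_pos13 H.compl hrb hra hqb' hqa' (by simp [hδ'])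
        (by simp [bool_true_of_not_false hε])

/-- Position `15` for every colouring. -/
theorem sq_pos15_any (H : SqCtx U F c0 c1 q r b a b' a') (hrb : r ∈ b) (hra : r ∈ a)
    (hqb' : q ∈ b') (hqa' : q ∈ a') : False := by
  by_cases hδ : c1 b = false
  · by_cases hε : c1 b' = false
    · exact sq_core_pos15 H hrb hra hqb' hqa' hδ hε
    · exact sq_core_pos15 H.swap_ab' hrb hra hqa' hqb' hδ
        (c1_other_eq_false H.hopp' (bool_true_of_not_false hε))
  · have hδ' := bool_true_of_not_false hδ
    by_cases hε : c1 b' = false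
    · exact sq_core_pos15 H.compl.swap_ab' hrb hra hqa' hqb' (by simp [hδ'])
        (by simp [c1_other_eq_true H.hopp' hε])
    · exact sq_core_pos15 H.compl hrb hra hqb' hqa' (by simp [hδ'])
        (by simp [bool_true_of_not_false hε])

/-- Position `5` for every colouring: the colour swap fixes `c1 b`. -/
theorem sq_pos5_any (H : SqCtx U F c0 c1 q r b a b' a') (hrb : r ∈ b) (hra : r ∉ a)
    (hqb' : q ∈ b') (hqa' : q ∉ a') :
    ∃ x, q ∉ x ∧ r ∉ x ∧ qEdges q F = {x, insert r x} ∧ qEdges r F = {x, insert q x} := by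
  by_cases hδ : c1 b = false
  · exact sq_core_pos5 H hrb hra hqb' hqa' hδ
  · exact sq_core_pos5 H.compl hrb hra hqb' hqa' (by simp [bool_true_of_not_false hδ])

end Normalisers

section Assembly

/-- **The square lemma from the context**: dispatch of the sixteen positions to the six orbit
representatives by the symmetries of `SqCtx`. -/
theorem square_core (H : SqCtx U F c0 c1 q r b a b' a') :
    ∃ x, q ∉ x ∧ r ∉ x ∧ qEdges q F = {x, insert r x} ∧ qEdges r F = {x, insert q x} := by
  by_cases hrb : r ∈ b <;> by_cases hra : r ∈ a <;> by_cases hqb' : q ∈ b' <;>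
    by_cases hqa' : q ∈ a'
  · exact (sq_pos15_any H hrb hra hqb' hqa').elim
  · exact (sq_pos13_any H.swap_qr hqb' hqa' hrb hra).elim
  · exact (sq_pos13_any H.swap_qr.swap_ab hqa' hqb' hrb hra).elim
  · exact (sq_pos12_any H.swap_qr hqb' hqa' hrb hra).elim
  · exact (sq_pos13_any H hrb hra hqb' hqa').elim
  · exact sq_pos5_any H hrb hra hqb' hqa'
  · exact sq_pos5_any H.swap_ab' hrb hra hqa' hqb'
  · exact (sq_pos4_any H.swap_qr hqb' hqa' hrb hra).elim
  · exact (sq_pos13_any H.swap_ab hra hrb hqb' hqa').elim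
  · exact sq_pos5_any H.swap_ab hra hrb hqb' hqa'
  · exact sq_pos5_any H.swap_ab.swap_ab' hra hrb hqa' hqb'
  · exact (sq_pos4_any H.swap_qr.swap_ab' hqb' hqa' hra hrb).elim
  · exact (sq_pos12_any H hrb hra hqb' hqa').elim
  · exact (sq_pos4_any H hrb hra hqb' hqa').elim
  · exact (sq_pos4_any H.swap_ab' hrb hra hqa' hqb').elim
  · exact (sq_pos0_any H hrb hra hqb' hqa').elim

/-- **THE SQUARE LEMMA**: two bad two-edge points `q ≠ r` have the four endpoints of their
edges in common: `K_q = {x, x + r}` and `K_r = {x, x + q}` for a set `x` avoiding both points. -/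
theorem square_of_badTwo (hq : BadTwo U F c0 c1 q) (hr : BadTwo U F c0 c1 r) (hqr : q ≠ r) :
    ∃ x, q ∉ x ∧ r ∉ x ∧ qEdges q F = {x, insert r x} ∧ qEdges r F = {x, insert q x} := by
  obtain ⟨b, a, b', a', H⟩ := exists_sqCtx hq hr hqr
  exact square_core H

/-- Two squares at the same point in two directions force the directions to coincide. -/
theorem eq_of_pair_eq_pair {x y : Finset α} {r p : α} (hrx : r ∉ x) (hpy : p ∉ y)
    (h : ({x, insert r x} : Finset (Finset α)) = {y, insert p y}) : r = p := by
  have hx : x ∈ ({y, insert p y} : Finset (Finset α)) := by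
    rw [← h]; exact mem_insert_self x _
  have hxr : insert r x ∈ ({y, insert p y} : Finset (Finset α)) := by
    rw [← h]; exact mem_insert_of_mem (mem_singleton_self _)
  rcases mem_insert.1 hx with hxy | hxy
  · -- `x = y`: then `x + r = x + p`
    subst hxy
    rcases mem_insert.1 hxr with h1 | h1
    · exact absurd (h1 ▸ mem_insert_self r x) hrx
    · rw [mem_singleton] at h1
      have hmem : r ∈ insert p x := h1 ▸ mem_insert_self r x
      rcases mem_insert.1 hmem with h2 | h2
      · exact h2
      · exact absurd h2 hrx
  · -- `x = y + p`: both memberships of `x + r` are impossible by cardinality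
    rw [mem_singleton] at hxy
    rcases mem_insert.1 hxr with h1 | h1
    · have hc := congrArg Finset.card h1
      rw [card_insert_of_notMem hrx, hxy, card_insert_of_notMem hpy] at hc
      omega
    · rw [mem_singleton] at h1
      have hr' : r ∉ insert p y := by rw [← hxy]; exact hrx
      rw [hxy] at h1
      have hc := congrArg Finset.card h1
      rw [card_insert_of_notMem hr'] at hc
      omega

/-- **THEOREM: three bad two-edge points are impossible.** -/
theorem noThreeTwo : NoThreeTwo α := by
  intro U F c0 c1 q r p hq hr hp hqr hqp hrp
  obtain ⟨x, -, hrx, hKq, -⟩ := square_of_badTwo hq hr hqr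
  obtain ⟨y, -, hpy, hKq', -⟩ := square_of_badTwo hq hp hqp
  exact hrp (eq_of_pair_eq_pair hrx hpy (hKq.symm.trans hKq'))

/-- **The core of (Ω) holds.** -/
theorem omegaCore_holds : OmegaCore α := omegaCore_of_noThreeTwo noThreeTwo

/-- **Conjecture (Ω) holds.** -/
theorem conjOmega_holds : ConjOmega α := conjOmega_of_noThreeTwo noThreeTwo

/-- **Conjecture (Σ) holds.** -/
theorem conjSigma_holds [Fintype α] : ConjSigma α := conjSigma_of_noThreeTwo noThreeTwo

end Assembly

end PercRepro.MSTight
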